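import Literature.AlgebraicGeometry.Resolution.CotangentIndependenceSpread
import Literature.AlgebraicGeometry.Resolution.SmoothStalksRegular
import Summits.ResolutionOfSingularities.ResolutionOfSingularities.Theorems.WeightedInvariantRegularSubschemeCentre
import HarnessLib

/-!
# Door H2b (ALGEBRAIZE) — formal point moves are algebraic (jets), and a move at ONE point is a weighted chart NEAR it

Route `ResolutionOfSingularities/WeightedInvariant`, crux `Theses.WeightedInvariant.HypersurfaceCentreConstruction`
(stmt-ResolutionOfSingularities-19897), door line `local-engine`, CRUX-PLAN §v6.2 H2b «Algebraize» of
`res-L1-w43-plan-1` (seat res-L1-w43-stub-9 = res-D-brk-1 converted): the filtration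
`weightedMonomialIdeal u w` (`(u^α : Σ wᵢ αᵢ ≥ n)`, Włodarczyk Lemma 2.1.12) is MULTIPLICATIVE and each
parameter `uᵢ` lies in its own piece of degree `wᵢ`; consequently the filtration does not change when every
`uᵢ` is perturbed inside the piece of degree `wᵢ` — in a local ring with all weights `≥ 1` and `u`
generating `𝔪`, any `v ≡ u (mod 𝔪^N)`, `N ≥ max wᵢ`, defines the SAME weighted filtration («point moves
depend only on `(max w)`-jets»: a formal point move of the local weighted game is already algebraic).
Second part (A2, door-shaped): on a scheme locally of finite type over a PERFECT field, sections `u₁, …, u_m`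
that are part of a regular system of parameters at ONE point `y` (regular local ring) and any positive weights
give a WEIGHTED CHART (`ReesAlgebraData.IsWeightedChart`, Włodarczyk 2.1.10) on an affine neighbourhood of `y`
for every Rees algebra whose pieces there are the weighted monomial ideals of the `uᵢ` — the independence of
the differentials spreads to all points of `V(u)` near `y` (`Resolution.CotangentIndependenceSpread`:
openness of the regular loci of the quotients `𝒪/(uᵢ : i ∈ T)` over a perfect field, Matsumura 14.2 in its
minimal form). Def-free helper lemmas (`--supports stmt-ResolutionOfSingularities-19897`); nothing here is a
claim about Hironaka's problem, and no regular weighted centre is asserted to exist unconditionally.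
-/

noncomputable section

set_option linter.dupNamespace false -- mandated namespace of this single-conjunct summit

namespace Summit.ResolutionOfSingularities.ResolutionOfSingularities.Theorems

open CategoryTheory AlgebraicGeometry TopologicalSpace IsLocalRing
open Literature.AlgebraicGeometry.Resolution

/-! ## A1. Weighted monomial filtrations depend only on jets -/

section Jets

variable {A : Type*} [CommRing A] {m : ℕ}

/-- A monomial `u^α` of weighted degree `Σ wᵢ αᵢ ≥ n` lies in the piece of degree `n`. [folklore] -/
theorem prod_pow_mem_weightedMonomialIdeal (u : Fin m → A) (w : Fin m → ℕ) {n : ℕ} (α : Fin m → ℕ)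
    (hα : n ≤ ∑ i, w i * α i) : ∏ i, u i ^ α i ∈ weightedMonomialIdeal u w n :=
  Ideal.subset_span ⟨α, hα, rfl⟩

/-- Each parameter `uᵢ` lies in the piece of degree `wᵢ` (the monomial with `α = eᵢ`).
[cite: Wlodarczyk2022, Lemma 2.1.12] -/
theorem self_mem_weightedMonomialIdeal (u : Fin m → A) (w : Fin m → ℕ) (i : Fin m) :
    u i ∈ weightedMonomialIdeal u w (w i) := by
  have h := prod_pow_mem_weightedMonomialIdeal u w (n := w i) (Pi.single i 1) (by
    rw [Finset.sum_eq_single i (fun j _ hj => by simp [hj]) (fun hi => absurd (Finset.mem_univ i) hi)]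
    simp)
  rwa [Finset.prod_eq_single i (fun j _ hj => by simp [hj]) (fun hi => absurd (Finset.mem_univ i) hi),
    Pi.single_eq_same, pow_one] at h

/-- Powers: `x ∈ I_a ⇒ x^k ∈ I_{k·a}`. [folklore] -/
theorem pow_mem_weightedMonomialIdeal (u : Fin m → A) (w : Fin m → ℕ) {a : ℕ} {x : A}
    (hx : x ∈ weightedMonomialIdeal u w a) (k : ℕ) : x ^ k ∈ weightedMonomialIdeal u w (a * k) := by
  induction k with
  | zero => rw [pow_zero, Nat.mul_zero, weightedMonomialIdeal_zero]; exact Submodule.mem_top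
  | succ k ih =>
    rw [pow_succ, Nat.mul_succ]
    exact weightedMonomialIdeal_mul_le u w _ _ (Ideal.mul_mem_mul ih hx)

/-- Weighted products: if `xᵢ ∈ I_{wᵢ}` for all `i` then `∏ xᵢ^{αᵢ} ∈ I_{Σ wᵢ αᵢ}`. [folklore] -/
theorem prod_pow_mem_weightedMonomialIdeal_of_mem (u : Fin m → A) (w : Fin m → ℕ) {x : Fin m → A}
    (hx : ∀ i, x i ∈ weightedMonomialIdeal u w (w i)) (α : Fin m → ℕ) :
    ∏ i, x i ^ α i ∈ weightedMonomialIdeal u w (∑ i, w i * α i) := by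
  classical
  induction (Finset.univ : Finset (Fin m)) using Finset.induction_on with
  | empty => rw [Finset.prod_empty, Finset.sum_empty, weightedMonomialIdeal_zero]; exact Submodule.mem_top
  | insert i s hi ih =>
    rw [Finset.prod_insert hi, Finset.sum_insert hi, Nat.add_comm]
    exact weightedMonomialIdeal_mul_le u w _ _
      (Ideal.mul_mem_mul (by simpa [Nat.mul_comm] using ih) (pow_mem_weightedMonomialIdeal u w (hx i) (α i)))
      |> fun h => by simpa [Nat.add_comm, Nat.mul_comm, mul_comm] using h

/-- **Jets lemma (one inclusion).** If every `vᵢ` lies in the degree-`wᵢ` piece of the weighted filtration of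
`u` — in particular if `vᵢ − uᵢ ∈ I_{wᵢ}(u)` — then the whole weighted filtration of `v` is contained in
that of `u`: `I_n(v) ⊆ I_n(u)` for every `n`. [cite: Wlodarczyk2022, Lemma 2.1.12] -/
theorem weightedMonomialIdeal_le_of_forall_mem (u v : Fin m → A) (w : Fin m → ℕ)
    (hv : ∀ i, v i ∈ weightedMonomialIdeal u w (w i)) (n : ℕ) :
    weightedMonomialIdeal v w n ≤ weightedMonomialIdeal u w n := by
  rw [weightedMonomialIdeal, Ideal.span_le]
  rintro _ ⟨α, hα, rfl⟩
  exact weightedMonomialIdeal_antitone u w hα (prod_pow_mem_weightedMonomialIdeal_of_mem u w hv α)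

/-- **Jets lemma (perturbation form).** If `vᵢ − uᵢ ∈ I_{wᵢ}(u)` for all `i`, then `I_n(v) ⊆ I_n(u)` for
all `n`. [cite: Wlodarczyk2022, Lemma 2.1.12] -/
theorem weightedMonomialIdeal_le_of_forall_sub_mem (u v : Fin m → A) (w : Fin m → ℕ)
    (hv : ∀ i, v i - u i ∈ weightedMonomialIdeal u w (w i)) (n : ℕ) :
    weightedMonomialIdeal v w n ≤ weightedMonomialIdeal u w n :=
  weightedMonomialIdeal_le_of_forall_mem u v w
    (fun i => by simpa using Ideal.add_mem _ (hv i) (self_mem_weightedMonomialIdeal u w i)) n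

/-- **Jets lemma (equality).** If `vᵢ − uᵢ ∈ I_{wᵢ}(u)` and `uᵢ − vᵢ ∈ I_{wᵢ}(v)` for all `i`, the two
weighted filtrations coincide. [cite: Wlodarczyk2022, Lemma 2.1.12] -/
theorem weightedMonomialIdeal_eq_of_forall_sub_mem (u v : Fin m → A) (w : Fin m → ℕ)
    (hv : ∀ i, v i - u i ∈ weightedMonomialIdeal u w (w i))
    (hu : ∀ i, u i - v i ∈ weightedMonomialIdeal v w (w i)) (n : ℕ) :
    weightedMonomialIdeal v w n = weightedMonomialIdeal u w n :=
  le_antisymm (weightedMonomialIdeal_le_of_forall_sub_mem u v w hv n)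
    (weightedMonomialIdeal_le_of_forall_sub_mem v u w hu n)

/-- If `u` generates the ideal `M` and all weights are `≥ 1`, then `M^n ⊆ I_n(u)` for every `n`
(each generator has weighted degree `≥ 1`). [cite: Wlodarczyk2022, Lemma 2.1.12] -/
theorem pow_le_weightedMonomialIdeal_of_span_eq (u : Fin m → A) (w : Fin m → ℕ) (hw : ∀ i, 0 < w i)
    {M : Ideal A} (hM : Ideal.span (Set.range u) = M) (n : ℕ) : M ^ n ≤ weightedMonomialIdeal u w n := by
  have h1 : M ≤ weightedMonomialIdeal u w 1 := by
    rw [← hM, Ideal.span_le]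
    rintro _ ⟨i, rfl⟩
    exact weightedMonomialIdeal_antitone u w (hw i) (self_mem_weightedMonomialIdeal u w i)
  induction n with
  | zero => rw [pow_zero, Ideal.one_eq_top, weightedMonomialIdeal_zero]
  | succ n ih =>
    rw [pow_succ]
    exact (Ideal.mul_mono ih h1).trans (weightedMonomialIdeal_mul_le u w n 1)

/-- **Point moves depend only on jets.** Let `u` and `v` both generate the ideal `M` (e.g. two systems of
parameters of a local ring generating its maximal ideal), all weights `wᵢ ≥ 1`, `N ≥ wᵢ` for all `i`, and
`vᵢ ≡ uᵢ (mod M^N)`. Then `v` defines the same weighted filtration as `u`: `I_n(v) = I_n(u)` for all `n`.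
(«point centres algebraize»: a weighted point move of the formal game read through any `(max w)`-jet of its
parameters is the same move.) [cite: Wlodarczyk2022, Lemma 2.1.12] -/
theorem weightedMonomialIdeal_eq_of_sub_mem_pow (u v : Fin m → A) (w : Fin m → ℕ) (hw : ∀ i, 0 < w i)
    {M : Ideal A} (hMu : Ideal.span (Set.range u) = M) (hMv : Ideal.span (Set.range v) = M) {N : ℕ}
    (hN : ∀ i, w i ≤ N) (hv : ∀ i, v i - u i ∈ M ^ N) (n : ℕ) :
    weightedMonomialIdeal v w n = weightedMonomialIdeal u w n := by
  refine weightedMonomialIdeal_eq_of_forall_sub_mem u v w (fun i => ?_) (fun i => ?_) n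
  · exact pow_le_weightedMonomialIdeal_of_span_eq u w hw hMu (w i) (Ideal.pow_le_pow_right (hN i) (hv i))
  · refine pow_le_weightedMonomialIdeal_of_span_eq v w hw hMv (w i) (Ideal.pow_le_pow_right (hN i) ?_)
    rw [← neg_sub]
    exact neg_mem (hv i)

/-- **Nakayama bookkeeping for perturbed generators**: if `u` generates a finitely generated ideal `M`
contained in the Jacobson radical (e.g. the maximal ideal of a local ring) and `vᵢ ≡ uᵢ (mod M²)`, then `v`
generates `M` as well. [folklore] -/
theorem span_eq_of_sub_mem_sq (u v : Fin m → A) {M : Ideal A} (hMu : Ideal.span (Set.range u) = M)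
    (hMjac : M ≤ Ideal.jacobson ⊥) (hv : ∀ i, v i - u i ∈ M ^ 2) : Ideal.span (Set.range v) = M := by
  have hfg : M.FG := by
    rw [← hMu]
    exact Submodule.fg_def.mpr ⟨Set.range u, Set.finite_range u, rfl⟩
  apply le_antisymm
  · rw [Ideal.span_le]
    rintro _ ⟨i, rfl⟩
    have hu : u i ∈ M := hMu ▸ Ideal.subset_span ⟨i, rfl⟩
    have h2 : v i - u i ∈ M := Ideal.pow_le_self two_ne_zero (hv i)
    simpa using M.add_mem h2 hu
  · -- `M ≤ span v ⊔ M • M`, then Nakayama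
    refine Submodule.le_of_le_smul_of_le_jacobson_bot hfg hMjac ?_
    rw [← hMu, Ideal.span_le]
    rintro _ ⟨i, rfl⟩
    have hdec : u i = v i - (v i - u i) := by ring
    rw [hdec]
    refine Ideal.sub_mem _ (Ideal.mem_sup_left (Ideal.subset_span ⟨i, rfl⟩)) (Ideal.mem_sup_right ?_)
    rw [Ideal.smul_eq_mul, ← pow_two, hMu]
    exact hv i

/-- **Point moves depend only on jets, local-ring form.** In a local ring, let `u` generate the maximal ideal
`𝔪`, all weights `wᵢ ≥ 1`, and `N ≥ max(2, wᵢ)`; then every `v` with `vᵢ ≡ uᵢ (mod 𝔪^N)` again generates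
`𝔪` and defines the same weighted filtration `I_n(v) = I_n(u)`. [cite: Wlodarczyk2022, Lemma 2.1.12] -/
theorem weightedMonomialIdeal_eq_of_sub_mem_maximalIdeal_pow [IsLocalRing A] (u v : Fin m → A)
    (w : Fin m → ℕ) (hw : ∀ i, 0 < w i) (hMu : Ideal.span (Set.range u) = IsLocalRing.maximalIdeal A)
    {N : ℕ} (hN2 : 2 ≤ N) (hN : ∀ i, w i ≤ N) (hv : ∀ i, v i - u i ∈ IsLocalRing.maximalIdeal A ^ N) :
    Ideal.span (Set.range v) = IsLocalRing.maximalIdeal A ∧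
      ∀ n, weightedMonomialIdeal v w n = weightedMonomialIdeal u w n := by
  have hMv : Ideal.span (Set.range v) = IsLocalRing.maximalIdeal A :=
    span_eq_of_sub_mem_sq u v hMu (IsLocalRing.maximalIdeal_le_jacobson ⊥)
      (fun i => Ideal.pow_le_pow_right hN2 (hv i))
  exact ⟨hMv, fun n => weightedMonomialIdeal_eq_of_sub_mem_pow u v w hw hMu hMv hN hv n⟩

end Jets

/-! ## A2. A move at one point is a weighted chart on a neighbourhood -/

section Chart

universe u

/-- **ALGEBRAIZE, chart form.** Let `Y` be locally of finite type over a perfect field `k`, `U ⊆ Y` an affine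
open, `y ∈ U` a point with `𝒪_{Y,y}` regular, `u₁, …, u_m ∈ Γ(Y, U)` vanishing at `y` with linearly independent
classes in `𝔪_y/𝔪_y²` (part of a regular system of parameters AT `y`), and `w` positive weights. Then there is
an affine open `y ∈ V ⊆ U` such that EVERY Rees algebra `R` on `Y` whose pieces over `V` are the weighted
monomial ideals `(u|_V^α : Σ wᵢ αᵢ ≥ n)` has `(V, u|_V, w)` as a weighted chart (Włodarczyk 2.1.10: the `uᵢ` are
part of a regular system of parameters at every point of `V(u) ∩ V`). [cite: Wlodarczyk2022, 2.1.10 and Lemma 2.1.12] -/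
theorem exists_affineOpens_isWeightedChart_of_linearIndependent {k : Type u} [Field k] [PerfectField k]
    {Y : Scheme.{u}} (f : Y ⟶ Spec (.of k)) [LocallyOfFiniteType f] (U : Y.affineOpens) {y : Y}
    (hy : y ∈ (U : Y.Opens)) [IsRegularLocalRing (Y.presheaf.stalk y)] {m : ℕ} (u : Fin m → Γ(Y, U))
    (hu : ∀ i, (Y.presheaf.germ (U : Y.Opens) y hy).hom (u i) ∈ maximalIdeal (Y.presheaf.stalk y))
    (hli : LinearIndependent (ResidueField (Y.presheaf.stalk y))
      fun i => (maximalIdeal (Y.presheaf.stalk y)).toCotangent ⟨_, hu i⟩)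
    (w : Fin m → ℕ) (hw : ∀ i, 0 < w i) :
    ∃ (V : Y.affineOpens) (hVU : (V : Y.Opens) ≤ U), y ∈ (V : Y.Opens) ∧
      ∀ R : ReesAlgebraData Y,
        (∀ n, (R.piece n).ideal V =
          weightedMonomialIdeal (fun i => (Y.presheaf.map (homOfLE hVU).op).hom (u i)) w n) →
        R.IsWeightedChart V (fun i => (Y.presheaf.map (homOfLE hVU).op).hom (u i)) w := by
  obtain ⟨V, hVU, hyV, hspread⟩ := exists_affineOpens_forall_linearIndependent_toCotangent f U hy u hu hli
  exact ⟨V, hVU, hyV, fun R hR => ⟨hw, hR, fun y' hy' h => (hspread y' hy' h).2⟩⟩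

/-- **ALGEBRAIZE, chart form, smooth ambient** (the door's regime: `Y → Spec k` smooth, `k` perfect): as
`exists_affineOpens_isWeightedChart_of_linearIndependent`, the regularity of `𝒪_{Y,y}` being automatic
(Stacks 056S, tree `isRegularLocalRing_stalk_of_smooth_of_field`). [cite: Wlodarczyk2022, 2.1.10] -/
theorem exists_affineOpens_isWeightedChart_of_linearIndependent_of_smooth {k : Type u} [Field k]
    [PerfectField k] {Y : Scheme.{u}} (f : Y ⟶ Spec (.of k)) [Smooth f] (U : Y.affineOpens) {y : Y}
    (hy : y ∈ (U : Y.Opens)) {m : ℕ} (u : Fin m → Γ(Y, U))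
    (hu : ∀ i, (Y.presheaf.germ (U : Y.Opens) y hy).hom (u i) ∈ maximalIdeal (Y.presheaf.stalk y))
    (hli : LinearIndependent (ResidueField (Y.presheaf.stalk y))
      fun i => (maximalIdeal (Y.presheaf.stalk y)).toCotangent ⟨_, hu i⟩)
    (w : Fin m → ℕ) (hw : ∀ i, 0 < w i) :
    ∃ (V : Y.affineOpens) (hVU : (V : Y.Opens) ≤ U), y ∈ (V : Y.Opens) ∧
      ∀ R : ReesAlgebraData Y,
        (∀ n, (R.piece n).ideal V =
          weightedMonomialIdeal (fun i => (Y.presheaf.map (homOfLE hVU).op).hom (u i)) w n) →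
        R.IsWeightedChart V (fun i => (Y.presheaf.map (homOfLE hVU).op).hom (u i)) w := by
  haveI : IsRegularLocalRing (Y.presheaf.stalk y) := isRegularLocalRing_stalk_of_smooth_of_field f y
  exact exists_affineOpens_isWeightedChart_of_linearIndependent f U hy u hu hli w hw

end Chart

/-! ## A3. Glue for the e.f.t. move format (appended 2026-08-27, res-L1-w43-stub-9): units, zero weights, minimal generators -/

section Glue

variable {A : Type*} [CommRing A] {m : ℕ}

/-- **Unit scaling does not change the weighted filtration**: if `vᵢ = tᵢ uᵢ` with `tᵢ` units, then
`I_n(v) = I_n(u)` for all `n` (e.g. clearing denominators of germs by units of the local ring).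
[cite: Wlodarczyk2022, Lemma 2.1.12] -/
theorem weightedMonomialIdeal_eq_of_forall_isUnit_mul (u v : Fin m → A) (w : Fin m → ℕ) (t : Fin m → A)
    (ht : ∀ i, IsUnit (t i)) (hv : ∀ i, v i = t i * u i) (n : ℕ) :
    weightedMonomialIdeal v w n = weightedMonomialIdeal u w n := by
  refine le_antisymm (weightedMonomialIdeal_le_of_forall_mem u v w (fun i => ?_) n)
    (weightedMonomialIdeal_le_of_forall_mem v u w (fun i => ?_) n)
  · rw [hv i]
    exact Ideal.mul_mem_left _ _ (self_mem_weightedMonomialIdeal u w i)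
  · obtain ⟨c, hc⟩ := (ht i).exists_left_inv
    have : u i = c * v i := by rw [hv i, ← mul_assoc, hc, one_mul]
    rw [this]
    exact Ideal.mul_mem_left _ _ (self_mem_weightedMonomialIdeal v w i)

/-- **Zero-weight parameters are redundant**: if the injection `σ : Fin m' → Fin m` hits every index of positive weight
(typically: `σ` enumerates exactly `{i | wᵢ > 0}`), then the weighted filtration of `(u, w)` is that of the sub-family
`(u ∘ σ, w ∘ σ)` — a move of the local game with some weights `0` (positive-dimensional centre `V(uᵢ : wᵢ > 0)`) is read
by the all-weights-positive charts of `ReesAlgebraData.IsWeightedChart` without re-typing.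
[cite: Wlodarczyk2022, Lemma 2.1.12] -/
theorem weightedMonomialIdeal_eq_comp_of_forall_mem_range {m' : ℕ} (u : Fin m → A) (w : Fin m → ℕ)
    (σ : Fin m' → Fin m) (hσ : Function.Injective σ) (hsurj : ∀ i, 0 < w i → i ∈ Set.range σ) (n : ℕ) :
    weightedMonomialIdeal u w n = weightedMonomialIdeal (u ∘ σ) (w ∘ σ) n := by
  classical
  apply le_antisymm
  · -- a monomial `u^α` is a multiple of the monomial in the positively weighted variables, of the same weight
    rw [weightedMonomialIdeal, Ideal.span_le]
    rintro _ ⟨α, hα, rfl⟩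
    have hsplit : ∏ i, u i ^ α i =
        (∏ i ∈ Finset.univ.filter (fun i => i ∉ Set.range σ), u i ^ α i) *
          ∏ i ∈ Finset.univ.filter (fun i => i ∈ Set.range σ), u i ^ α i := by
      rw [mul_comm, Finset.prod_filter_mul_prod_filter_not]
    have hreidx : ∏ i ∈ Finset.univ.filter (fun i => i ∈ Set.range σ), u i ^ α i = ∏ j, (u ∘ σ) j ^ α (σ j) := by
      rw [show Finset.univ.filter (fun i => i ∈ Set.range σ) = Finset.univ.image σ by
        ext i; simp [Set.mem_range, eq_comm]]
      rw [Finset.prod_image (fun j _ j' _ h => hσ h)]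
      rfl
    have hwt : n ≤ ∑ j, (w ∘ σ) j * α (σ j) := by
      refine hα.trans (le_of_eq ?_)
      have hzero : ∀ i ∈ Finset.univ.filter (fun i => i ∉ Set.range σ), w i * α i = 0 := by
        intro i hi
        have hi' : i ∉ Set.range σ := (Finset.mem_filter.mp hi).2
        have : w i = 0 := by
          by_contra h
          exact hi' (hsurj i (Nat.pos_of_ne_zero h))
        rw [this, zero_mul]
      rw [← Finset.sum_filter_add_sum_filter_not Finset.univ (fun i => i ∈ Set.range σ),
        Finset.sum_eq_zero hzero, add_zero,
        show Finset.univ.filter (fun i => i ∈ Set.range σ) = Finset.univ.image σ by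
          ext i; simp [Set.mem_range, eq_comm],
        Finset.sum_image (fun j _ j' _ h => hσ h)]
      rfl
    rw [hsplit, hreidx]
    exact Ideal.mul_mem_left _ _ (prod_pow_mem_weightedMonomialIdeal (u ∘ σ) (w ∘ σ) (fun j => α (σ j)) hwt)
  · -- a monomial in the sub-family is a monomial of `u` with exponent extended by zero
    rw [weightedMonomialIdeal, Ideal.span_le]
    rintro _ ⟨β, hβ, rfl⟩
    let α : Fin m → ℕ := fun i => if h : i ∈ Set.range σ then β (Classical.choose h) else 0
    have hασ : ∀ j, α (σ j) = β j := by
      intro j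
      have h : σ j ∈ Set.range σ := ⟨j, rfl⟩
      simp only [α, dif_pos h]
      congr 1
      exact hσ (Classical.choose_spec h)
    have hprod : ∏ j, (u ∘ σ) j ^ β j = ∏ i, u i ^ α i := by
      rw [← Finset.prod_filter_mul_prod_filter_not Finset.univ (fun i => i ∈ Set.range σ)]
      have h1 : ∏ i ∈ Finset.univ.filter (fun i => i ∉ Set.range σ), u i ^ α i = 1 :=
        Finset.prod_eq_one fun i hi => by
          have hi' : i ∉ Set.range σ := (Finset.mem_filter.mp hi).2
          simp only [α, dif_neg hi', pow_zero]
      rw [h1, mul_one, show Finset.univ.filter (fun i => i ∈ Set.range σ) = Finset.univ.image σ by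
        ext i; simp [Set.mem_range, eq_comm], Finset.prod_image (fun j _ j' _ h => hσ h)]
      exact Finset.prod_congr rfl fun j _ => by rw [Function.comp_apply, hασ j]
    have hwt : n ≤ ∑ i, w i * α i := by
      refine hβ.trans (le_of_eq ?_)
      rw [← Finset.sum_filter_add_sum_filter_not Finset.univ (fun i => i ∈ Set.range σ)]
      have h0 : ∑ i ∈ Finset.univ.filter (fun i => i ∉ Set.range σ), w i * α i = 0 :=
        Finset.sum_eq_zero fun i hi => by
          have hi' : i ∉ Set.range σ := (Finset.mem_filter.mp hi).2
          simp only [α, dif_neg hi', mul_zero]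
      rw [h0, add_zero, show Finset.univ.filter (fun i => i ∈ Set.range σ) = Finset.univ.image σ by
        ext i; simp [Set.mem_range, eq_comm], Finset.sum_image (fun j _ j' _ h => hσ h)]
      exact Finset.sum_congr rfl fun j _ => by rw [Function.comp_apply, hασ j]
    rw [hprod]
    exact prod_pow_mem_weightedMonomialIdeal u w α hwt

/-- **A minimal generating system of the maximal ideal of a regular local ring has independent differentials**
(the move clause «`span u = 𝔪_S ∧ spanFinrank 𝔪_S = n`» of the e.f.t. local game delivers the hypothesis of
`exists_affineOpens_isWeightedChart_of_linearIndependent`, for the whole system and hence for every sub-family).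
[cite: Matsumura1987, Thm. 14.2] -/
theorem linearIndependent_toCotangent_of_span_eq_of_spanFinrank_eq {R : Type*} [CommRing R] [IsRegularLocalRing R]
    {n : ℕ} (u : Fin n → R) (hspan : Ideal.span (Set.range u) = maximalIdeal R)
    (hn : (maximalIdeal R).spanFinrank = n) :
    LinearIndependent (ResidueField R) fun i =>
      (maximalIdeal R).toCotangent ⟨u i, hspan ▸ Ideal.subset_span ⟨i, rfl⟩⟩ := by
  rw [linearIndependent_toCotangent_iff_forall_mem]
  exact fun c hc i => mem_maximalIdeal_of_sum_mul_rsop_mem_sq hn u hspan c hc i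

/-- Sub-families of a family with independent differentials have independent differentials (e.g. the positively
weighted parameters of a move). [cite: Matsumura1987, Thm. 14.2] -/
theorem linearIndependent_toCotangent_comp {R : Type*} [CommRing R] [IsLocalRing R] {n m' : ℕ} (u : Fin n → R)
    (hu : ∀ i, u i ∈ maximalIdeal R)
    (hli : LinearIndependent (ResidueField R) fun i => (maximalIdeal R).toCotangent ⟨u i, hu i⟩)
    (σ : Fin m' → Fin n) (hσ : Function.Injective σ) :
    LinearIndependent (ResidueField R) fun j => (maximalIdeal R).toCotangent ⟨u (σ j), hu (σ j)⟩ :=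
  hli.comp σ hσ

end Glue

end Summit.ResolutionOfSingularities.ResolutionOfSingularities.Theorems

end
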